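import Summits.AnomalousDissipation.AnomalousDissipation.Theorems.QuarticGate.Negative.LevelCeiling
import Summits.AnomalousDissipation.AnomalousDissipation.Theorems.CubicParityLoud.Negative.EnergyRow
import Summits.AnomalousDissipation.AnomalousDissipation.Theorems.MomentParityMomentClosure
import Summits.AnomalousDissipation.AnomalousDissipation.Theorems.MomentParityResolvedDissipationStubStretchingBound
import Summits.AnomalousDissipation.AnomalousDissipation.Theorems.MomentParityResolvedDissipationStubTruncatedPalinstrophy
import Summits.AnomalousDissipation.AnomalousDissipation.Theorems.MomentParityResolvedDissipationStubResolvedOfTails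
import Summits.AnomalousDissipation.AnomalousDissipation.Theorems.MomentParityResolvedDissipationStubCertificateAveraging
import Literature.Analysis.FluidPDE.ZerothLaw

/-!
# Line `enstrophy-ui-level-ledger` — CHECKED skeleton for the crux `MomentParity.ResolvedDissipation`
# (stmt-AnomalousDissipation-14284; route `route-AnomalousDissipation-MomentParity`, rank-5 crux)
# — LEAD's copy, gen-1 lead `prover-line-stmt-AnomalousDissipation-14284-1` (picked 2026-08-16): stubs S1–S5
#   registered VERBATIM from the planner's skeleton. WAVE 1 LANDED S1/S2/S3/S5 (all ACCEPTED, sorry-free, by name +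
#   signature): S1 `…MomentParityResolvedDissipation.StretchingBound.stub_stretchingBound` p97141, S2
#   `…TruncatedPalinstrophy.stub_truncatedPalinstrophy` p96221, S3 `…ResolvedOfTails.stub_resolvedOfTails` p96255,
#   S5 `…CertificateAveraging.stub_certificateAveraging` p96818. ONE `sorry` LEFT: S4 `stub_certificate` (held by the
#   lead) — the crux in certificate currency (see its docstring and `## Census` of the lead's NOTES).

crux-plan seat `planner-cruxplan-stmt-AnomalousDissipation-14284-enstrophy-ui-level-l-0`, 2026-08-16.
Idea card `Cruxes/ResolvedDissipation/Ideas/enstrophy-ui-level-ledger.md` (crux-ideate r1, ideator 1);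
triage r1-1 / r1-2 / r1-3: pass ×3, MERGED by the panel with `enstrophy-ui-transfer` (ideator 2) and
`enstrophy-ui-shell-balance` (ideator 3) — one lever (RD ⟺ N-uniform uniform integrability of the
enstrophy `Z = ‖∇u‖²`, via the level-truncated Foias–Guillopé–Temam bound); this skeleton is the merged
UI line in the CERTIFICATE currency of the card's piece (4). Line card: `Lines/enstrophy-ui-level-ledger.md`.

## The line in one paragraph

`ResolvedDissipation` (RD) asks, at FIXED `(f, ν > 0, R)`, for ONE resolution schedule `κ` of the mean
enstrophy of every level-`N` Galerkin-invariant law in the ball `B_R`, uniformly in `N`. The tail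
`‖∇Q_K u‖²` is bounded by the palinstrophy `|Au|² / (4π²(K²+1))` on every bounded-enstrophy stratum
`{Z ≤ Λ}` and by `Z` itself above it, so RD splits (S3, `stub_resolvedOfTails`) into
(i) an `N`-uniform bound on `∫_{Z ≤ Λ} |Au|² dμ` — the LEVEL-TRUNCATED FGT bound S2
(`stub_truncatedPalinstrophy`: stationarity tested on a `C¹` function of `Z`, the torus Agmon /
vortex-stretching bound S1 `stub_stretchingBound`, Young), provable now — and (ii) `N`-uniform decay of
the enstrophy tails `∫_{Z > Λ} Z dμ`, i.e. UNIFORM INTEGRABILITY of `Z` over all admissible laws, which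
is EQUIVALENT to the crux (E1 of the triage) and is the whole difficulty. The line attacks (ii) in its
dual, pointwise form: by Tobasco–Goluskin–Doering sharpness (tree fact
`Literature.Dynamics.Ergodic.TobascoGoluskinDoering2018_measureForm`) uniform tail decay holds IFF there
are AUXILIARY-FUNCTIONAL CERTIFICATES `Φ_{Λ,N}` (band-limited `C¹` cylindrical functionals) with
`(Z − Λ)₊ + L_N Φ_{Λ,N} ≤ η(Λ)·(1 + Z)` pointwise on the level-`N` ball, `η(Λ) → 0` uniformly in `N`
(S4, `stub_certificate`, THE BET; the slack `η·(1+Z)` is free because `⟨Z⟩ ≤ ‖f‖R/ν` uniformly — it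
absorbs every injection-type term, so the certificate only has to fight the energy transported across
enstrophy levels, the card's LEVEL LEDGER); S5 (`stub_certificateAveraging`) is the easy duality
direction for the crux's admissibility class (stationarity for polynomial tests ⇒ for `C¹_c` cylindrical
tests by the LANDED density upgrade `MomentParityMomentClosure.integral_nsGeneratorPairing_grad_eq_zero`,
plus the energy row `CubicParityLoud.Negative.ensembleDissipation_eq_of_energyRow`).

## Composition (kernel-checked, no `sorry` of its own)

`tails_of_certificate : S4 → S5 → (uniform enstrophy tails)` (pure logic + one real inequality, PROVED
below) and
`ResolvedDissipation_of : ResolvedDissipation :=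
   fun f … ν … R => stub_resolvedOfTails f ν R (stub_truncatedPalinstrophy stub_stretchingBound f … R)
     (tails_of_certificate stub_certificate stub_certificateAveraging f … R)` (repackaged to the crux's
binders). Dependency DAG: S1 → S2; (S4, S5) → tails; (S2, tails) → S3 → crux BY NAME.

## Vocabulary policy (for the lead)

NO new definitions. Every statement is over LANDED vocabulary: `IsLevel`, `IsBandTest`, `polyGrad`,
`IsPolyStationary` of `Theorems/QuarticGate/Negative/LevelCeiling.lean` (the crux's clauses named; the
crux's all-degree stationarity clause is `∀ d, IsPolyStationary ν f N d μ`, and `IsLevel`/`IsBandTest`/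
`polyGrad` unfold to the crux's sub-terms by `rfl`, which is how `ResolvedDissipation_of` repackages),
`T3 R3 H3` of `Theorems/CubicParityLoud/Negative/Clauses.lean`, `Torus.eGradNormSq` (= `Z`),
`Literature.Analysis.FluidPDE.eLaplacianNormSq` (= palinstrophy `|Au|² = ‖Δu‖²`, ZerothLaw.lean),
`Torus.fourierTruncate`, `Torus.inertialPairing`, `Torus.nsGeneratorPairing`, `Torus.CylindricalTest`.
So every stub lands VERBATIM by name + signature as `Theorems/ResolvedDissipation/<Stub>.lean
--supports stmt-AnomalousDissipation-14284`, with no vocabulary file to land first. The two copies of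
`IsLevel` in the tree (`QuarticGate.Negative`, used here and by `Disproof.lean`; `CubicParityLoud.Negative`,
used by the energy row and the density upgrade) are definitionally equal (`Iff.rfl`).

## Disproof.lean used (`Cruxes/ResolvedDissipation/Disproof.lean`, cdisprove cycle 1b, read in full)

* `resolvedDissipation_false_without_nu_pos`: `0 < ν` is spent in S2 (constants `ν⁻¹·(… + c′Λ³/ν³)`),
  in S5 (energy row `⟨Z⟩ ≤ ‖f‖R/ν`) and in S4 (the certificate scale); at `ν = 0` S4 is false
  (equipartition laws of truncated Euler violate UI), consistently.
* `resolvedDissipation_false_without_stationarity`: stationarity is spent in S2 (row of `φ(Z)`) and S5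
  (row of the certificate `Φ` and the energy row) — through NON-polynomial `C¹` observables, i.e. at
  unbounded degree (NegativeNotesIdeator1 B4: no bounded degree suffices).
* `resolvedDissipation_false_without_level`: the carrier clause `IsLevel N u` is in every stub (S1 needs
  trigonometric polynomials; S2/S5 need the compact carrier for the density upgrade; S4 is stated on it).
* `resolvedDissipationLevelwise_holds` (§3: `∀ N ∃ κ` is trivial): `κ` is built in S3 from the `N`-free
  data `Λ(ε)` (tails) and `C(Λ)` (S2) — an `N`-UNIFORM modulus, as §3 demands.
* `not_resolvedDissipationUniformInForce` (§4): every constant is chosen after `f` (`C` of S2 carries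
  `‖Δf‖₂R`, `B` of S5 carries `‖f‖₂R/ν`, `Λ` of S4 depends on `f`).
* §5 kill shape / §6 `ensembleEnstrophy_le_of_isStationary`: §6 is exactly the bound S5 re-derives from
  the landed energy row; no `-- Targets` stub kills exist; no `Theorems/ResolvedDissipation/Negative/`
  lemma has landed, so no stub instantiates a refuted statement (`ledger negatives`: 0204, 13037, 2979,
  2984, 2859 — all `ν → 0` / non-zero-mean statements, unrelated).

## Relation to the sibling line `Lines/enstrophy_ui_transfer.lean` (same crux, merged idea)

That skeleton (stubs A `stub_torusAgmon`, F `stub_fgtMoment`, T `stub_transfer`, U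
`stub_uniformIntegrability`) registers the Transfer `C⁺ = UI` ITSELF as the hard stub. Here S1 ⟸ A +
integration by parts + Hölder (S1 packages the stretching bound the way S2/F consume it); S2 ⟸ F with
`C = (1+Λ)² C_FGT` (strata are weaker than the mixed moment); S3 is T restricted to the admissible
family with strata in place of the weight (same proof, template above); and `tails_of_certificate`'s
statement IS U up to `ℝ` vs `ℝ≥0∞` thresholds. The lines differ exactly in the hard part: U (a statement
about measures) versus S4 + S5 (a POINTWISE certificate on phase space + its averaging). A lead who picks
either line can import the other's infrastructure stubs verbatim.

## Triage answers acted on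

* r1-1/r1-3 "give `TruncatedPalinstrophy` its explicit constant so `κ(n)` is closed-form": S2 keeps
  `∃ C` (the Agmon constant of S1 is not numerically known in tree) but S3 is stated so that ANY `C(Λ)`
  and ANY tail modulus `Λ(ε)` produce `κ` — the closed form `κ(n) = ⌈((n+1) C(Λ(1/(2(n+1)))) / (2π²))^{1/2}⌉`
  is in the line card.
* r1-1 (c) "torus Agmon is absent, M-sized — FLAG for crux-plan": it is its own stub S1, in the general
  bilinear form `|∫(u⊗u):∇w| ≤ c Z^{3/4} |Au|^{1/2}… ‖w‖₂` that also yields the card's bandwidth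
  inequality (take `w = Au − λu`).
* r1-2 "by TGD minimax the Certificate stub is EQUIVALENT to the crux, so only a SPECIFIC W is content":
  accepted — S4 is stated as the existence of certificates (equivalent to RD, see the card), and the
  specific ansatz `Φ = V_Λ + W` (explicit `V_Λ = ½|u|² g_Λ(Z)/ν` + precursor `W`) is the attack plan in
  the line card, not hard-coded into the stub (a mis-cut there would have to be reshaped by the lead).
* r1-3 "merged skeleton: E1 → localisation → ONE hard stub": this is that skeleton (S1–S3 = E1 made of
  genuine lemmas; S4 the one hard stub; S5 its averaging).
-/

noncomputable section

-- `Summit.<Summit>.<Problem>`: single-conjunct summit, the duplicate namespace segment is mandated.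
set_option linter.dupNamespace false

namespace Summit.AnomalousDissipation.AnomalousDissipation.Cruxes.ResolvedDissipation.EnstrophyUiLevelLedger

open MeasureTheory Filter Topology
open scoped ENNReal InnerProductSpace RealInnerProductSpace
open Literature.Analysis.FunctionSpaces Literature.Analysis.FluidPDE
open Summit.AnomalousDissipation.AnomalousDissipation.Theses.MomentParity
open Summit.AnomalousDissipation.AnomalousDissipation.Theorems.CubicParityLoud.Negative (T3 R3 H3)
open Summit.AnomalousDissipation.AnomalousDissipation.Theorems.QuarticGate.Negative
  (IsLevel IsBandTest polyGrad IsPolyStationary)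

/-! ## §1 The five registered stubs

Conventions. `Z u = Torus.eGradNormSq (u.1 : T3 → R3) ∈ ℝ≥0∞` is the spectral enstrophy `‖∇u‖₂²`,
`eLaplacianNormSq (u.1 : T3 → R3) ∈ ℝ≥0∞` the palinstrophy `|Au|² = ‖Δu‖₂²` (both finite on level-`N`
fields); an ADMISSIBLE LAW at `(f, ν, R, N)` is a `μ : Measure H3` with the crux's four hypotheses
`IsProbabilityMeasure μ`, `∀ᵐ u ∂μ, IsLevel N u`, `∀ᵐ u ∂μ, ‖u‖ ≤ R`, `∀ d, IsPolyStationary ν f N d μ`. -/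

/-- **S1 · `stub_stretchingBound` (torus Agmon / vortex-stretching bound; size M).** There is an
absolute constant `c` such that for every level-`N` field `u ∈ H` (a divergence-free mean-zero vector
trigonometric polynomial) and every smooth field `w`,
`|∫ (u ⊗ u) : ∇w| ≤ c ‖∇u‖₂^{3/2} ‖Δu‖₂^{1/2} ‖w‖₂`.
Proof sketch: integrate by parts (`div u = 0`): `∫(u⊗u):∇w = −∫ (u·∇u)·w`, so the left side is
`≤ ‖u‖_∞ ‖∇u‖₂ ‖w‖₂`; Agmon on `𝕋³` for mean-zero trigonometric polynomials,
`‖u‖_∞ ≤ Σ_k |û(k)| ≤ c ‖∇u‖₂^{1/2} ‖Δu‖₂^{1/2}` (Cauchy–Schwarz on `|k| ≤ ρ` and `|k| > ρ` with the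
lattice sums `Σ_{0<|k|≤ρ} |k|⁻² ≲ ρ`, `Σ_{|k|>ρ} |k|⁻⁴ ≲ ρ⁻¹`, then optimise `ρ`). In tree: the lattice sum
`Torus.tsum_agmonWeight_le` (Literature `FunctionSpaces/TorusAgmonLatticeSum.lean`, proved), and — in the
sibling crux's work file `Cruxes/UniformResolution/Disproof.lean` §2–3 (sorry-free, NOT importable: copy)
— the dyadic sup bound `norm_realTrigPoly_le_agmon`, `integral_sum_norm_sq_partialDeriv_realTrigPoly`,
`integral_norm_sq_laplacian_realTrigPoly`, `integral_norm_sq_convect_self_le`; what remains is the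
integration by parts `∫(u⊗u):∇w = −∫⟪(u·∇)u, w⟫` for divergence-free trigonometric polynomials, the
`L²` representative bookkeeping (`fourierTruncate_ae_eq_of_isLevel`) and the optimisation of the cut.
With `w = Au = −ΔP_N u` this is the classical `|b(u,u,Au)| ≤ c Z^{3/4} |Au|^{3/2}` used by S2; with
`w = Au − λu` it is the card's bandwidth inequality (`b(u,u,u) = 0`).
[folklore; Constantin–Foias 1988 Ch. 4, FMRT2001 II (A.29), (A.43)] -/
theorem stub_stretchingBound :
    ∃ c : ℝ, 0 ≤ c ∧ ∀ (N : ℕ) (u : H3), IsLevel N u → ∀ w : T3 → R3, Torus.IsSmooth w →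
      |Torus.inertialPairing u.1 w| ≤
        c * (Torus.eGradNormSq (u.1 : T3 → R3)).toReal ^ (3 / 4 : ℝ) *
          (eLaplacianNormSq (u.1 : T3 → R3)).toReal ^ (1 / 4 : ℝ) *
            (∫ x, ‖w x‖ ^ 2) ^ (1 / 2 : ℝ) :=
  Summit.AnomalousDissipation.AnomalousDissipation.Theorems.MomentParityResolvedDissipation.StretchingBound.stub_stretchingBound

/-- **S2 · `stub_truncatedPalinstrophy` (level-truncated Foias–Guillopé–Temam bound; size L).**
Given S1: for every `(f, ν > 0, R)` and every enstrophy level `Λ` there is `C = C(f, ν, R, Λ)` such that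
EVERY admissible law at EVERY level `N` has `∫_{Z ≤ Λ} |Au|² dμ ≤ C` — bounded-enstrophy strata are
resolved uniformly in `N`. Proof sketch (triage D1/E1, re-derived by all three triagers): test
stationarity on the cylindrical functional `u ↦ φ(Z(u)) − φ(∞)` with `φ' = ψ`, `ψ = 1` on `[0, Λ]`,
`ψ = 0` on `[2Λ, ∞)`, `0 ≤ ψ ≤ 1` (a `C¹_c` profile of the Galerkin-frame coordinates, admissible by the
landed density upgrade `integral_nsGeneratorPairing_grad_eq_zero`; on level-`N` fields
`Z = 4π² Σ_a |k_a|² (u, e_a)²` by the frame identity `sum_integral_inner_frameField_sq`); its row is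
`0 = ∫ ψ(Z)·2[(f, Au) − ν|Au|² + ∫(u⊗u):∇(Au)] dμ` with `Au = −ΔP_N u`; bound `|(f, Au)| = |(Δf, u)| ≤
‖Δf‖₂ R` and, by S1 + Young, `|∫(u⊗u):∇(Au)| ≤ c Z^{3/4}|Au|^{3/2} ≤ (ν/2)|Au|² + c′Z³/ν³`
(`c′ = 27c⁴/32`); hence `(ν/2) ∫ ψ(Z)|Au|² ≤ ‖Δf‖₂R + c′(2Λ)² ∫ Z dμ/ν³ ≤ ‖Δf‖₂R + 4c′Λ²‖f‖₂R/ν⁴`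
(energy row `∫ Z dμ ≤ ‖f‖₂R/ν`, landed) and `C = (2‖Δf‖₂R + 8c′Λ²‖f‖₂R/ν⁴)/ν` works — the triage's
`C(f,R,ν)(1 + Λ²⟨Z⟩/ν³)`. Equivalently S2 follows from the sibling line's FGT mixed moment
`∫ |Au|²/(1+Z)² dμ ≤ C_FGT` with `C = (1+Λ)² C_FGT`. `R < 0` is vacuous, `Λ < 0` trivial.
[FoiasGuillopeTemam1981; FMRT2001 IV (3.6), (A.43)] -/
theorem stub_truncatedPalinstrophy :
    (∃ c : ℝ, 0 ≤ c ∧ ∀ (N : ℕ) (u : H3), IsLevel N u → ∀ w : T3 → R3, Torus.IsSmooth w →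
      |Torus.inertialPairing u.1 w| ≤
        c * (Torus.eGradNormSq (u.1 : T3 → R3)).toReal ^ (3 / 4 : ℝ) *
          (eLaplacianNormSq (u.1 : T3 → R3)).toReal ^ (1 / 4 : ℝ) *
            (∫ x, ‖w x‖ ^ 2) ^ (1 / 2 : ℝ)) →
    ∀ f : T3 → R3, Torus.IsSmooth f → Torus.IsDivFree f → Torus.HasZeroMean f →
    ∀ ν : ℝ, 0 < ν → ∀ R Λ : ℝ, ∃ C : ℝ, ∀ (N : ℕ) (μ : Measure H3), IsProbabilityMeasure μ →
      (∀ᵐ u ∂μ, IsLevel N u) → (∀ᵐ u ∂μ, ‖u‖ ≤ R) → (∀ d : ℕ, IsPolyStationary ν f N d μ) →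
      ∫⁻ u in {u : H3 | Torus.eGradNormSq (u.1 : T3 → R3) ≤ ENNReal.ofReal Λ},
          eLaplacianNormSq (u.1 : T3 → R3) ∂μ ≤ ENNReal.ofReal C :=
  Summit.AnomalousDissipation.AnomalousDissipation.Theorems.MomentParityResolvedDissipation.TruncatedPalinstrophy.stub_truncatedPalinstrophy

/-- **S3 · `stub_resolvedOfTails` (the E1 transfer, direction used; size M).** At fixed `(f, ν, R)`:
IF bounded-enstrophy strata are resolved (`∀ Λ ∃ C ∀ admissible (N, μ): ∫_{Z≤Λ}|Au|² dμ ≤ C`, the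
shape of S2) AND the enstrophy tails decay uniformly (`∀ ε>0 ∃ Λ ∀ admissible (N, μ): ∫_{Z>Λ} Z dμ ≤ ε`),
THEN one schedule `κ` resolves every admissible law at every level — the crux's conclusion verbatim.
Proof sketch (triage D2): pointwise in `ℝ≥0∞`, `Z = Z∘P_K + tail_K`
(`eGradNormSq_fourierTruncate_eq_sum` / `tailGradNormSq`), `tail_K ≤ |Au|²/(4π²(K²+1))` (termwise:
`4π²|k|² ≤ 16π⁴|k|⁴/(4π²(K²+1))` for `|k|² ≥ K²+1`, cf. `sq_add_one_le_freqNormSq_of_not_mem`) and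
`tail_K ≤ Z` (`tailGradNormSq_le`); split `∫ tail_K dμ` over `{Z ≤ Λ}` and `{Z > Λ}`:
`∫ tail_K ≤ C(Λ)/(4π²(K²+1)) + ε`. Given `n` take `ε = 1/(2(n+1))`, its `Λ`, then `C(Λ)`, then
`κ n = K` with `C(Λ)/(4π²(K²+1)) ≤ 1/(2(n+1))`. No stationarity is used beyond the two hypotheses; all
quantities stay in `ℝ≥0∞` (no integrability side conditions). TEMPLATE (sorry-free, ~110 lines, NOT
importable: copy): `Cruxes/UniformResolution/Disproof.lean` §H
`exists_isResolved_of_uniformlyIntegrable_of_weightedH2` proves exactly this transfer for an abstract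
family with the FGT-weighted hypothesis (`tailGradNormSq_mul_le_eLapNormSq`,
`eGradNormSq_eq_fourierTruncate_add_tail`, `measurable_eLapNormSq_coe` there; its local `eLapNormSq` is
`eLaplacianNormSq` by `eHomSobolevSeminorm_two_sq_eq_tsum'`); replace its weight step by the stratum
hypothesis. [folklore; FMRT2001 IV §1] -/
theorem stub_resolvedOfTails :
    ∀ (f : T3 → R3) (ν R : ℝ),
    (∀ Λ : ℝ, ∃ C : ℝ, ∀ (N : ℕ) (μ : Measure H3), IsProbabilityMeasure μ →
      (∀ᵐ u ∂μ, IsLevel N u) → (∀ᵐ u ∂μ, ‖u‖ ≤ R) → (∀ d : ℕ, IsPolyStationary ν f N d μ) →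
      ∫⁻ u in {u : H3 | Torus.eGradNormSq (u.1 : T3 → R3) ≤ ENNReal.ofReal Λ},
          eLaplacianNormSq (u.1 : T3 → R3) ∂μ ≤ ENNReal.ofReal C) →
    (∀ ε : ℝ, 0 < ε → ∃ Λ : ℝ, ∀ (N : ℕ) (μ : Measure H3), IsProbabilityMeasure μ →
      (∀ᵐ u ∂μ, IsLevel N u) → (∀ᵐ u ∂μ, ‖u‖ ≤ R) → (∀ d : ℕ, IsPolyStationary ν f N d μ) →
      ∫⁻ u in {u : H3 | ENNReal.ofReal Λ < Torus.eGradNormSq (u.1 : T3 → R3)},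
          Torus.eGradNormSq (u.1 : T3 → R3) ∂μ ≤ ENNReal.ofReal ε) →
    ∃ κ : ℕ → ℕ, ∀ (N : ℕ) (μ : Measure H3), IsProbabilityMeasure μ →
      (∀ᵐ u ∂μ, IsLevel N u) → (∀ᵐ u ∂μ, ‖u‖ ≤ R) → (∀ d : ℕ, IsPolyStationary ν f N d μ) →
      ∀ n : ℕ, ∫⁻ u, Torus.eGradNormSq (u.1 : T3 → R3) ∂μ ≤
        (∫⁻ u, Torus.eGradNormSq (Torus.fourierTruncate (κ n) (u.1 : T3 → R3)) ∂μ) +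
          ((n : ℝ≥0∞) + 1)⁻¹ :=
  Summit.AnomalousDissipation.AnomalousDissipation.Theorems.MomentParityResolvedDissipation.ResolvedOfTails.stub_resolvedOfTails

/-- **S4 · `stub_certificate` (THE BET — N-uniform auxiliary-functional certificates for the enstrophy
tail; size XL).** For every `(f, ν > 0, R)` and `η > 0` there is a level `Λ` such that at EVERY
Galerkin level `N` some band-limited `C¹_c` cylindrical functional `Φ = Φ_{Λ,N}` satisfies, pointwise on
the level-`N` fields of the ball `B_R`,
`(Z(u) − Λ)₊ + ⟨F(u), Φ'(u)⟩ ≤ η · (1 + Z(u))`,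
where `⟨F(u), Φ'(u)⟩ = nsGeneratorPairing ν f u (Φ.grad u)` IS the Galerkin generator `L_N Φ` on such
`u` (band-limited tests). The slack `η(1+Z)` costs nothing downstream (`⟨Z⟩ ≤ ‖f‖R/ν` uniformly, S5) and
absorbs every injection-type term. EQUIVALENT to the crux: S4 ⇒ RD is this file; RD ⇒ UI at every radius
(Chebyshev, `Z_{≤K} ≤ 4π²K²R²`) ⇒ at each `N`, by Tobasco–Goluskin–Doering sharpness on the compact
forward-invariant ball `B_{R'} ∩ P_N H`, `R' = max(R, ‖f‖₂/(4π²ν))` (tree fact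
`TobascoGoluskinDoering2018_measureForm`, (b) = (c)), a `C¹` certificate with
`max[(Z−Λ)₊ + L_N V] ≤ sup_μ ∫(Z−Λ)₊ dμ + η/2 ≤ η`, realised as a cylindrical functional of the
Galerkin-frame coordinates with a cutoff outside the ball. So S4 is the crux in CERTIFICATE CURRENCY,
not a restatement: one explicit object per `(Λ, N)`, no measure, and `N`-uniformity = one continuum
functional restricted to `P_N H` whose `L_N`-bound uses only `P_N`-stable inequalities. ATTACK (line
card): `Φ = V_Λ + W`, `V_Λ = ½|u|² g_Λ(Z)/ν` (`g_Λ ↑ 1` across `[Λ/2, Λ]`) gives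
`(Z−Λ)₊ + L_N V_Λ ≤ (f,u) g_Λ(Z)/ν + ½|u|² g_Λ'(Z)(L_N Z)/ν` EXACTLY (the level ledger, pointwise), whose
first term is `≤ (2‖f‖₂R/(νΛ))·Z` (slack) and whose second — energy carried across the level, `> 0` only
on ascending slab states, which are infrared-confined (`|Au|² ≤ 2‖Δf‖₂R/ν + 2c′Z³/ν⁴`) and must carry
bandwidth (S1 with `w = Au − λu`) — is what the PRECURSOR `W` must pay for. WHY IT MIGHT FAIL: no
certificate that is a function of finitely many Sobolev seminorms exists (ladder wall, NegativeNotesIdeator1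
B2; seminorm caricature, NegativeNotesIdeator3G2 BN6) — `W` must see the spectral distribution / spatial
geometry; and ¬S4 ⟺ ¬RD ⟺ fixed-`ν` Leray–Hopf anomalous dissipation of a Galerkin-limit ensemble
(Disproof.lean ¶1), open both ways. [TobascoGoluskinDoering2018 eq. (8); FantuzziGoluskinHuangChernyshenko
doi:10.1137/15m1053347; arXiv:1807.08956; FoiasGuillopeTemam1981] -/
theorem stub_certificate :
    ∀ f : T3 → R3, Torus.IsSmooth f → Torus.IsDivFree f → Torus.HasZeroMean f →
    ∀ ν : ℝ, 0 < ν → ∀ R : ℝ, ∀ η : ℝ, 0 < η → ∃ Λ : ℝ, ∀ N : ℕ,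
      ∃ Φ : Torus.CylindricalTest (Fin 3), (∀ i, IsBandTest N (Φ.g i)) ∧
        ∀ u : H3, IsLevel N u → ‖u‖ ≤ R →
          max ((Torus.eGradNormSq (u.1 : T3 → R3)).toReal - Λ) 0 +
              Torus.nsGeneratorPairing ν f u (Φ.grad u) ≤
            η * (1 + (Torus.eGradNormSq (u.1 : T3 → R3)).toReal) := by
  sorry

/-- **S5 · `stub_certificateAveraging` (certificates bound invariant averages — weak duality for the
crux's admissibility class; size M).** For every `(f, ν > 0, R)` there is `B = B(f, ν, R) ≥ 0`
(`B = 2(1 + ‖f‖₂R/ν)` works) such that for every admissible law `μ` at level `N`, every band-limited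
cylindrical `Φ` and all reals `Λ, η`: the pointwise certificate `(Z − Λ)₊ + ⟨F(u), Φ'(u)⟩ ≤ η(1 + Z)` on
the level-`N` fields of `B_R` forces `∫_{Z > 2Λ} Z dμ ≤ B·η`. Proof sketch: (a) `∫ ⟨F(u), Φ'(u)⟩ dμ = 0`
— stationarity against every polynomial in the band-limited fields `Φ.g` (hypothesis, all degrees)
upgrades to the `C¹_c` profile by the LANDED `MomentParityMomentClosure.integral_nsGeneratorPairing_grad_eq_zero`
on the compact carrier `{IsLevel N} ∩ B_R` (`isCompact_levelBall`); (b) integrate the certificate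
(`(Z−Λ)₊` is bounded and continuous on the carrier, `continuous_bandEnstrophy`):
`∫ (Z−Λ)₊ dμ ≤ η (1 + ∫ Z dμ)`; (c) the energy row `ν ∫ Z dμ = ∫ (u, f) dμ ≤ ‖f‖₂ R`
(`CubicParityLoud.Negative.ensembleDissipation_eq_of_energyRow`, from `IsPolyStationary ν f N 3 μ`);
(d) `Z > 2Λ ⇒ Z < 2(Z − Λ)₊` (any sign of `Λ`), so `∫⁻_{Z>2Λ} Z ≤ 2·ofReal ∫(Z−Λ)₊`. A negative `η` makes
the hypothesis contradictory (μ is a probability measure on the carrier), `R < 0` is vacuous.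
[TobascoGoluskinDoering2018 §2 (6)–(7) (weak duality); FMRT2001 IV §1.2] -/
theorem stub_certificateAveraging :
    ∀ f : T3 → R3, Torus.IsSmooth f → Torus.IsDivFree f → Torus.HasZeroMean f →
    ∀ ν : ℝ, 0 < ν → ∀ R : ℝ, ∃ B : ℝ, 0 ≤ B ∧
      ∀ (N : ℕ) (μ : Measure H3), IsProbabilityMeasure μ →
      (∀ᵐ u ∂μ, IsLevel N u) → (∀ᵐ u ∂μ, ‖u‖ ≤ R) → (∀ d : ℕ, IsPolyStationary ν f N d μ) →
      ∀ Φ : Torus.CylindricalTest (Fin 3), (∀ i, IsBandTest N (Φ.g i)) →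
      ∀ Λ η : ℝ,
        (∀ u : H3, IsLevel N u → ‖u‖ ≤ R →
          max ((Torus.eGradNormSq (u.1 : T3 → R3)).toReal - Λ) 0 +
              Torus.nsGeneratorPairing ν f u (Φ.grad u) ≤
            η * (1 + (Torus.eGradNormSq (u.1 : T3 → R3)).toReal)) →
        ∫⁻ u in {u : H3 | ENNReal.ofReal (2 * Λ) < Torus.eGradNormSq (u.1 : T3 → R3)},
            Torus.eGradNormSq (u.1 : T3 → R3) ∂μ ≤ ENNReal.ofReal (B * η) :=
  Summit.AnomalousDissipation.AnomalousDissipation.Theorems.MomentParityResolvedDissipation.CertificateAveraging.stub_certificateAveraging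

/-! ## §2 Proved glue (no `sorry`): certificates ⇒ uniform enstrophy tails -/

/-- **Uniform enstrophy tails from certificates** (S4 + S5, pure logic): given `ε > 0` take `B` from S5,
`η = ε/(B+1)`, the level `Λ` of S4 at `η`, and the threshold `2Λ`. This is the card's Transfer
`C⁺ = EnstrophyUI`, reached from the certificate side. -/
theorem tails_of_certificate
    (hcert : ∀ f : T3 → R3, Torus.IsSmooth f → Torus.IsDivFree f → Torus.HasZeroMean f →
      ∀ ν : ℝ, 0 < ν → ∀ R : ℝ, ∀ η : ℝ, 0 < η → ∃ Λ : ℝ, ∀ N : ℕ,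
        ∃ Φ : Torus.CylindricalTest (Fin 3), (∀ i, IsBandTest N (Φ.g i)) ∧
          ∀ u : H3, IsLevel N u → ‖u‖ ≤ R →
            max ((Torus.eGradNormSq (u.1 : T3 → R3)).toReal - Λ) 0 +
                Torus.nsGeneratorPairing ν f u (Φ.grad u) ≤
              η * (1 + (Torus.eGradNormSq (u.1 : T3 → R3)).toReal))
    (havg : ∀ f : T3 → R3, Torus.IsSmooth f → Torus.IsDivFree f → Torus.HasZeroMean f →
      ∀ ν : ℝ, 0 < ν → ∀ R : ℝ, ∃ B : ℝ, 0 ≤ B ∧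
        ∀ (N : ℕ) (μ : Measure H3), IsProbabilityMeasure μ →
        (∀ᵐ u ∂μ, IsLevel N u) → (∀ᵐ u ∂μ, ‖u‖ ≤ R) → (∀ d : ℕ, IsPolyStationary ν f N d μ) →
        ∀ Φ : Torus.CylindricalTest (Fin 3), (∀ i, IsBandTest N (Φ.g i)) →
        ∀ Λ η : ℝ,
          (∀ u : H3, IsLevel N u → ‖u‖ ≤ R →
            max ((Torus.eGradNormSq (u.1 : T3 → R3)).toReal - Λ) 0 +
                Torus.nsGeneratorPairing ν f u (Φ.grad u) ≤
              η * (1 + (Torus.eGradNormSq (u.1 : T3 → R3)).toReal)) →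
          ∫⁻ u in {u : H3 | ENNReal.ofReal (2 * Λ) < Torus.eGradNormSq (u.1 : T3 → R3)},
              Torus.eGradNormSq (u.1 : T3 → R3) ∂μ ≤ ENNReal.ofReal (B * η)) :
    ∀ f : T3 → R3, Torus.IsSmooth f → Torus.IsDivFree f → Torus.HasZeroMean f →
    ∀ ν : ℝ, 0 < ν → ∀ R : ℝ,
    ∀ ε : ℝ, 0 < ε → ∃ Λ : ℝ, ∀ (N : ℕ) (μ : Measure H3), IsProbabilityMeasure μ →
      (∀ᵐ u ∂μ, IsLevel N u) → (∀ᵐ u ∂μ, ‖u‖ ≤ R) → (∀ d : ℕ, IsPolyStationary ν f N d μ) →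
      ∫⁻ u in {u : H3 | ENNReal.ofReal Λ < Torus.eGradNormSq (u.1 : T3 → R3)},
          Torus.eGradNormSq (u.1 : T3 → R3) ∂μ ≤ ENNReal.ofReal ε := by
  intro f hfs hfd hfz ν hν R ε hε
  obtain ⟨B, hB0, hB⟩ := havg f hfs hfd hfz ν hν R
  have hB1 : 0 < B + 1 := by linarith
  have hη : 0 < ε / (B + 1) := div_pos hε hB1
  obtain ⟨Λ, hΛ⟩ := hcert f hfs hfd hfz ν hν R (ε / (B + 1)) hη
  refine ⟨2 * Λ, fun N μ hP hL hR hS => ?_⟩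
  obtain ⟨Φ, hΦ, hpt⟩ := hΛ N
  calc ∫⁻ u in {u : H3 | ENNReal.ofReal (2 * Λ) < Torus.eGradNormSq (u.1 : T3 → R3)},
          Torus.eGradNormSq (u.1 : T3 → R3) ∂μ
        ≤ ENNReal.ofReal (B * (ε / (B + 1))) := hB N μ hP hL hR hS Φ hΦ Λ (ε / (B + 1)) hpt
    _ ≤ ENNReal.ofReal ε := by
        refine ENNReal.ofReal_le_ofReal ?_
        rw [mul_div_assoc', div_le_iff₀ hB1]
        nlinarith

/-! ## §3 The skeleton theorem: the five stubs prove the crux BY NAME -/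

/-- **`ResolvedDissipation` from the five registered stubs.** S2 (fed S1) resolves every
bounded-enstrophy stratum uniformly in `N`; S4 + S5 (`tails_of_certificate`) make the enstrophy tails
uniformly small; S3 turns the two into ONE schedule `κ`; the crux's own clauses are recovered by
unfolding `IsLevel` / `IsBandTest` / `polyGrad` (`rfl`) and specialising the all-degree stationarity
hypothesis to each degree. The only gaps the audit sees are the five `sorry`s. -/
theorem ResolvedDissipation_of :
    Summit.AnomalousDissipation.AnomalousDissipation.Theses.MomentParity.ResolvedDissipation := by
  intro f hfs hfd hfz ν hν R
  obtain ⟨κ, hκ⟩ := stub_resolvedOfTails f ν R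
    (stub_truncatedPalinstrophy stub_stretchingBound f hfs hfd hfz ν hν R)
    (tails_of_certificate stub_certificate stub_certificateAveraging f hfs hfd hfz ν hν R)
  refine ⟨κ, fun N μ hP hL hB hS n => hκ N μ hP hL hB (fun d m g P hg _ => hS m g P hg) n⟩

end Summit.AnomalousDissipation.AnomalousDissipation.Cruxes.ResolvedDissipation.EnstrophyUiLevelLedger

end
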